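import Literature.AlgebraicGeometry.Frobenioids.FiniteEtaleBase
import Literature.AlgebraicGeometry.Frobenioids.ArchimedeanBaseCategory
import Literature.AlgebraicGeometry.Frobenioids.BaseCategoryFSMTypeProofs
import Literature.AlgebraicGeometry.Frobenioids.BCatOrbits
import Literature.AlgebraicGeometry.Frobenioids.PadicFrobenioidThm12Proofs
import Literature.AlgebraicGeometry.Frobenioids.UnitTrivializationFunctoriality
import Mathlib.CategoryTheory.Discrete.Basic
import HarnessLib

/-!
# Frobenioids I, §0 vocabulary («quasi-connected», «pseudo-terminal», «0-commutes») at the GENUINE base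
# categories and carriers of [FrdI]/[FrdII]/[IUTchI]: head-exact instance forms

Mochizuki, *The geometry of Frobenioids I: the general theory*, Kyushu J. Math. **62** (2008) 293–400, §0,
kurims text p. 14 («pseudo-terminal»), p. 15 («quasi-connected»: "In particular, it follows that if `C` is a
totally epimorphic category, then every object of `C` is quasi-connected"), p. 15 («`0`-commutes»)
[cite: MochizukiFrdI2008, §0 pp.14-15]; *The geometry of Frobenioids II: poly-Frobenioids*, ibid. 401–460, §1
p. 7 / §3 p. 23 (the base categories `D₀` are "connected, totally epimorphic") and Theorem 1.2 (iii) p. 9 ("If `D`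
admits a terminal object, then `C` admits a pseudo-terminal object") [cite: MochizukiFrdII2008, Thm 1.2 (iii) p.9].

PROOF-ONLY closer file (abc-iut cell, D-0079 L-F [FrdI/II] sub-cell, LF-FRD pack D rows F-0960 `IsPseudoTerminal`,
F-0961 `IsQuasiConnected`, F-0966 `ZeroCommutes` of `Categories.lean`; seat abc-iut-L1-t1 gen 8). The three rows are
§0 DEFINITIONS whose universal closures are refuted in the tree (`not_forall_isPseudoTerminal`,
`not_forall_isQuasiConnected`, `not_forall_zeroCommutes`); this file records, with conclusion HEAD literally the row's
declaration and NO hypothesis beyond the genuine data, the instance forms at the carriers print applies them to —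
each a one-line re-heading of a theorem already in the tree (cited BY NAME; nothing restated, no definition, no
instance, no `sorry`):

* «quasi-connected» (F-0961): every object of `D₀ = FinEtale F` ([FrdII] §1 p. 7 `Spec ℚ_p`, §3 p. 23 `Spec ℝ`;
  abc-iut-L1-t4's `FinEtale.isTotallyEpimorphic`), of the skeleton `ArchFrd.D0` of [FrdII] §3 (abc-iut-L1-t6's
  `ArchFrd.D0.isTotallyEpimorphic`), of the one-morphism base `Discrete PUnit` of [IUTchI] Ex. 3.2–3.4, of a Galois
  category at an SGA1-connected object ([FrdI] Rem. 3.1.3; `isConnectedObj_of_isConnected`) and of `B(Π)` at a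
  transitive `Π`-set ([FrdI] §0 p. 13; `BCat.isConnectedObj_of_transitive`) is quasi-connected — by the printed
  sentence `IsTotallyEpimorphic.isQuasiConnected` / "connected objects are always quasi-connected".
* «pseudo-terminal» (F-0960): `Spec F` is a pseudo-terminal (indeed terminal) object of `D₀ = FinEtale F`; and
  [FrdII] Thm. 1.2 (iii) at THE `p`-adic Frobenioid of [FrdII] Ex. 1.1 (abc-iut-L1-t4's `PadicFrd.Datum`): for `T`
  terminal in `D`, the object `(T, 0)` is pseudo-terminal (abc-iut-L1-d8's `ModelFrobenioid.isPseudoTerminal_zeroObj_of_cofinal`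
  with the cofinality of `Div_B` discharged by `PadicFrd.Datum.divB_cofinal`).
* «`0`-commutes» (F-0966): the square of [FrdI] Thm. 3.4 (iv), `(C₁^istr → C₁^un-tr) ⋙ Ψ^un-tr = Ψ^istr ⋙ (C₂^istr →
  C₂^un-tr)`, commutes in the literal sense (abc-iut-L1-d1's `PreFrobenioidData.toUntr_comp_untrMap`, whose type is
  this `ZeroCommutes` statement with head `Eq`).

Honest framing: FACT rows are assumption LABELS on OUR typed vocabulary; «PROVED» below = OUR kernel check of OUR typed
instance form; elementary category theory / Galois theory; nothing here bears on [IUTchIII] Cor. 3.12 or takes a side.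
-/

namespace Literature.AlgebraicGeometry.Frobenioids

open CategoryTheory CategoryTheory.Limits

universe w v u v₁ v₁' v₂ v₂' u₁ u₁' u₂ u₂' w₁ w₂

/-! ### F-0961 «quasi-connected» at the genuine base categories -/

/-- Every object `Spec K` of `D₀ = FinEtale F` (connected finite étale coverings of `Spec F`; [FrdII] §1 p. 7 for
`F = ℚ_p`, §3 p. 23 for `F = ℝ`) is quasi-connected: `D₀` is totally epimorphic, and "if `C` is a totally epimorphic
category, then every object of `C` is quasi-connected" ([FrdI] §0 p. 15). [cite: MochizukiFrdII2008, §1 p.7] -/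
theorem FinEtale.isQuasiConnected {F : Type u} [Field F] (X : FinEtale F) : IsQuasiConnected X :=
  FinEtale.isTotallyEpimorphic.isQuasiConnected X

/-- Every object of `D₀` over `Spec ℚ_p` ([FrdII] §1 p. 7) is quasi-connected. [cite: MochizukiFrdII2008, §1 p.7] -/
theorem PadicBase.isQuasiConnected (p : ℕ) [Fact p.Prime] (X : PadicBase p) : IsQuasiConnected X :=
  FinEtale.isQuasiConnected X

/-- Every object of `D₀` over `Spec ℝ` ([FrdII] §3 p. 23) is quasi-connected. [cite: MochizukiFrdII2008, §3 p.23] -/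
theorem ArchBase.isQuasiConnected (X : ArchBase) : IsQuasiConnected X :=
  FinEtale.isQuasiConnected X

/-- Every object of the skeleton `D₀ = {Spec ℝ, Spec ℂ}` of [FrdII] §3 (`ArchFrd.D0`, totally epimorphic by
`ArchFrd.D0.isTotallyEpimorphic`) is quasi-connected. [cite: MochizukiFrdII2008, §3 p.23] -/
theorem ArchFrd.D0.isQuasiConnected (X : ArchFrd.D0) : IsQuasiConnected X :=
  ArchFrd.D0.isTotallyEpimorphic.isQuasiConnected X

/-- Every object of the one-morphism base category `Discrete PUnit` ([FrdI] §0 p. 13; the base of [IUTchI]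
Ex. 3.2–3.4, the domain of `ArchFrd.ptBase`) is quasi-connected — it is not mobile (all hom-sets are
subsingletons). [cite: MochizukiFrdI2008, §0 p.15] -/
theorem isQuasiConnected_discretePUnit (X : Discrete PUnit.{w + 1}) : IsQuasiConnected X :=
  Or.inl fun ⟨_, f, g, hfg⟩ => hfg (Subsingleton.elim f g)

/-- In a Galois category, an SGA1-connected object is quasi-connected in the sense of [FrdI] §0 ("connected
objects are always quasi-connected", with abc-iut-L1-d7's `isConnectedObj_of_isConnected`, [FrdI] Rem. 3.1.3 /
[FrdII] §1 p. 7 "connected objects of the Galois category"). [cite: MochizukiFrdI2008, Rem. 3.1.3 p.58] -/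
theorem isQuasiConnected_of_isConnected {C : Type u} [Category.{v} C] [GaloisCategory C] (A : C)
    [PreGaloisCategory.IsConnected A] : IsQuasiConnected A :=
  (isConnectedObj_of_isConnected A).isQuasiConnected

/-- In `B(Π)` ([FrdI] §0 p. 13) a nonempty transitive `Π`-set is quasi-connected (it is connected,
`BCat.isConnectedObj_of_transitive`). [cite: MochizukiFrdI2008, §0 p.15] -/
theorem BCat.isQuasiConnected_of_transitive {G : Type u} [Group G] [TopologicalSpace G] [IsTopologicalGroup G]
    (X : BCat G) (x₀ : X.obj.V) (htr : ∀ x : X.obj.V, ∃ g : G, g • x₀ = x) : IsQuasiConnected X :=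
  (BCat.isConnectedObj_of_transitive X x₀ htr).isQuasiConnected

/-! ### F-0960 «pseudo-terminal» at the genuine base categories and at THE `p`-adic Frobenioid -/

/-- `Spec F` is a pseudo-terminal object of `D₀ = FinEtale F`: every `Spec K` maps to it by the structure map
([FrdI] §0 p. 14; [FrdII] §1 p. 7 / §3 p. 23). [cite: MochizukiFrdI2008, §0 p.14] -/
theorem FinEtale.isPseudoTerminal_base (F : Type u) [Field F] : IsPseudoTerminal (FinEtale.base F) :=
  fun X => ⟨FinEtale.toBase X⟩

/-- `Spec F` is a terminal object of `D₀ = FinEtale F` (the structure map `Spec K → Spec F` is the unique arrow: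
`F`-algebra maps `F → K` are unique). [cite: MochizukiFrdI2008, §0 p.14] -/
theorem FinEtale.isTerminalObj_base (F : Type u) [Field F] : IsTerminalObj (FinEtale.base F) :=
  ⟨IsTerminal.ofUniqueHom (fun X => FinEtale.toBase X) fun X _ =>
    FinEtale.hom_ext (Subsingleton.elim (α := F →ₐ[F] X) _ _)⟩

/-- `Spec ℚ_p` is a pseudo-terminal object of `D₀` over `Spec ℚ_p` ([FrdII] §1 p. 7).
[cite: MochizukiFrdII2008, §1 p.7] -/
theorem PadicBase.isPseudoTerminal_base (p : ℕ) [Fact p.Prime] : IsPseudoTerminal (FinEtale.base ℚ_[p]) :=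
  FinEtale.isPseudoTerminal_base ℚ_[p]

/-- `Spec ℝ` is a pseudo-terminal object of `D₀` over `Spec ℝ` ([FrdII] §3 p. 23).
[cite: MochizukiFrdII2008, §3 p.23] -/
theorem ArchBase.isPseudoTerminal_base : IsPseudoTerminal (FinEtale.base ℝ) :=
  FinEtale.isPseudoTerminal_base ℝ

/-- **[FrdII] Thm. 1.2 (iii) at THE `p`-adic Frobenioid** of [FrdII] Ex. 1.1 (`PadicFrd.Datum`, its Frobenioid the
model Frobenioid `ModelFrobenioid d.Φ d.B d.divB` of [FrdI] Thm. 5.2): if `T` is a terminal object of `D`, then the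
object `(T, 0)` is pseudo-terminal — "follows immediately from the construction of a model Frobenioid" (FrdII p. 9);
the cofinality of `Div_B` is `PadicFrd.Datum.divB_cofinal`. [cite: MochizukiFrdII2008, Thm 1.2 (iii) p.9] -/
theorem PadicFrd.Datum.isPseudoTerminal_zeroObj {D : Type u} [Category.{v} D] {p : ℕ} [Fact p.Prime]
    (d : PadicFrd.Datum D p) {T : D} (hT : IsTerminal T) :
    IsPseudoTerminal (ModelFrobenioid.zeroObj d.Φ d.B d.divB T) :=
  ModelFrobenioid.isPseudoTerminal_zeroObj_of_cofinal d.divB_cofinal hT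

/-! ### F-0966 «`0`-commutes»: the square of [FrdI] Thm. 3.4 (iv) commutes in the literal sense -/

/-- **[FrdI] Thm. 3.4 (iv)**: the square `(C₁^istr → C₁^un-tr) ⋙ Ψ^un-tr = Ψ^istr ⋙ (C₂^istr → C₂^un-tr)`
`0`-commutes ("commutes in the literal sense", [FrdI] §0 p. 15) — abc-iut-L1-d1's `PreFrobenioidData.toUntr_comp_untrMap`
re-headed as the §0 predicate. [cite: MochizukiFrdI2008, Thm. 3.4 (iv) p.63] -/
theorem PreFrobenioidData.zeroCommutes_untrMap {C₁ : Type u₁} [Category.{v₁} C₁] {D₁ : Type u₁'}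
    [Category.{v₁'} D₁] {C₂ : Type u₂} [Category.{v₂} C₂] {D₂ : Type u₂'} [Category.{v₂'} D₂]
    {S₁ : PreFrobenioidData.{w₁} C₁ D₁} {S₂ : PreFrobenioidData.{w₂} C₂ D₂} {Ψ : S₁.Istr ⥤ S₂.Istr}
    (hΨ : PreFrobenioidData.PreservesUnitEquiv S₁ S₂ Ψ) :
    ZeroCommutes S₁.toUntr (PreFrobenioidData.untrMap hΨ) Ψ S₂.toUntr :=
  PreFrobenioidData.toUntr_comp_untrMap hΨ

end Literature.AlgebraicGeometry.Frobenioids
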